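import Literature.Analysis.FluidPDE.SereginSverak2002PressureLowerBound
import Literature.Analysis.FluidPDE.SereginSverakPressure
import Literature.Analysis.FluidPDE.NSViscosityRescaling
import Literature.Analysis.FluidPDE.NSLerayHopfABCScaling
import HarnessLib

/-!
# Seregin–Šverák 2002, bounded majorant: reductions of the named fact (proofs only)

Proof file for the named fact `SereginSverak2002_pressureOneSidedBound`
(`SereginSverak2002PressureLowerBound.lean`; G. Seregin, V. Šverák, *Navier–Stokes equations
with lower bounds on the pressure*, Arch. Ration. Mech. Anal. **163** (2002) 65–86, main theorem
as stated in the abstract, bounded case `g ≡ M`). No statement is added or edited here; the file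
records, as PROVED theorems, how the fact sits in the tree:

* `IsBackwardBoundedAt.of_bound_Ioo` — a bound on a whole strip `(δ, T) × ℝ³`, `δ < t₀ ≤ T`,
  gives backward boundedness at `(t₀, x₀)` (radius `r = √(t₀ - δ)`).
* `SereginSverak2002_pressureOneSidedBound.of_final_time` — the fact is EQUIVALENT to its
  final-time case `t₀ = T` (`iff_final_time`): at interior times `t₀ < T` the velocity of a
  classical solution on `[0, T)` is continuous, hence backward bounded
  (`IsBackwardBoundedAt.of_continuousOn`). The mathematical content is "no blow-up at `t = T`".
* `SereginSverak2002_pressureOneSidedBound.of_seregin_sverak_2002` — the fact FOLLOWS from the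
  tree's other vendoring of the same printed theorem, the named fact
  `Literature.Analysis.FluidPDE.seregin_sverak_2002` (`SereginSverakPressure.lean`, transcribed
  from the restatement Tran–Yu 2017, Thm. 1: same hypotheses — classical on `[0, T)`,
  Leray–Hopf from a rapidly decaying datum, `|u|²/2 + p̃ ≤ K` or `p̃ ≥ -K` on `(0, T) × ℝ³` —
  with the STRONGER conclusion "`u` bounded on `(δ, T) × ℝ³` for every `δ ∈ (0, T)`"). The two
  hypothesis shapes are interchanged by `‖u‖² + 2p̃ ≤ M ↔ ‖u‖²/2 + p̃ ≤ M/2`; the conclusion is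
  localised by `IsBackwardBoundedAt.of_bound_Ioo` with `δ = t₀/2`.

Consequently the discharge `SereginSverak2002_pressureOneSidedBound_holds` is exactly as hard as
`seregin_sverak_2002_holds` (not in the tree: the primary source is cite-only here, acquisition
`acq-01580`; its proof — ε-regularity in terms of `sup_R A(v; z₀, R)` (the paper's Lemma 3.3),
the one-sided bound converting tested control of `p̃ = RᵢRⱼ(vᵢvⱼ)` into scale-invariant `L¹`
control, and a blow-up argument — is not vendored), and will be the one-liner
`of_seregin_sverak_2002 seregin_sverak_2002_holds` once that discharge lands.

* `SereginSverak2002_pressureOneSidedBound.of_unitViscosity` (appended 2026-08-15) — the fact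
  follows from its own `ν = 1` instance, written out in full as the hypothesis: the viscosity
  scaling `v(s, x) = ν⁻¹ u(s/ν, x)`, `π(s, x) = ν⁻² p(s/ν, x)` on `[0, νT)` (Tao 2011, footnote 3;
  the tree's `timeRescale`, `IsClassicalNSSolutionOn.viscosityRescale_set`,
  `IsLerayHopfOn.viscosityRescale`) keeps the class (rapid decay of `ν⁻¹ u₀`,
  `hasRapidSpatialDecay_const_smul`) and turns constant one-sided bounds into constant one-sided
  bounds (`p̃[ν⁻¹ w] = ν⁻² p̃[w]`, `normalisedPressure_smul`); backward boundedness of `v` at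
  `(ν t₀, x₀)` is backward boundedness of `u` at `(t₀, x₀)` (radius `r / max(1, ν)`). The
  ε-regularity inputs of the eventual discharge (`SereginSverak2002ACriterion.lean`) are at `ν = 1`.

## References

* G. Seregin, V. Šverák, Arch. Ration. Mech. Anal. 163 (2002) 65–86, main theorem (abstract).
  [SereginSverak2002]
* C. V. Tran, X. Yu, Appl. Math. Lett. 67 (2017) 21–27, Thm. 1 (restatement). [TranYu2017]
* T. Tao, arXiv:1108.1165, footnote 3 (viscosity normalisation). [Tao2011]
-/

noncomputable section

open Set Metric Function

namespace Literature.Analysis.FluidPDE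

namespace IsBackwardBoundedAt

variable {u : ℝ → EuclideanSpace ℝ (Fin 3) → EuclideanSpace ℝ (Fin 3)} {δ t₀ T C : ℝ}

/-- A velocity bound on a whole strip `(δ, T) × ℝ³` with `δ < t₀ ≤ T` gives backward boundedness
at every point `(t₀, x₀)` of the strip's closure in time: take the backward cylinder of radius
`r = √(t₀ - δ)`, whose time window is exactly `(δ, t₀) ⊆ (δ, T)`. [folklore] -/
theorem of_bound_Ioo (hδ : δ < t₀) (ht₀ : t₀ ≤ T)
    (hC : ∀ t ∈ Ioo δ T, ∀ x : EuclideanSpace ℝ (Fin 3), ‖u t x‖ ≤ C)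
    (x₀ : EuclideanSpace ℝ (Fin 3)) : IsBackwardBoundedAt u t₀ x₀ := by
  refine ⟨Real.sqrt (t₀ - δ), Real.sqrt_pos.2 (sub_pos.2 hδ), C, fun t ht x _ ↦ hC t ⟨?_, ?_⟩ x⟩
  · have h2 : Real.sqrt (t₀ - δ) ^ 2 = t₀ - δ := Real.sq_sqrt (sub_pos.2 hδ).le
    linarith [ht.1]
  · exact lt_of_lt_of_le ht.2 ht₀

end IsBackwardBoundedAt

namespace SereginSverak2002_pressureOneSidedBound

/-- **Reduction to the final time.** `SereginSverak2002_pressureOneSidedBound` follows from its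
case `t₀ = T` alone: for `t₀ ∈ (0, T)` the velocity of a classical solution on `[0, T) × ℝ³` is
jointly continuous there, hence bounded on a compact backward box around `(t₀, x₀)`
(`IsBackwardBoundedAt.of_continuousOn`); no hypothesis on the pressure is used at interior times.
[cite: SereginSverak2002, Main Theorem (abstract) – bounded case, content at t = T] -/
theorem of_final_time
    (h : ∀ (ν T : ℝ), 0 < ν → 0 < T →
      ∀ (u : ℝ → EuclideanSpace ℝ (Fin 3) → EuclideanSpace ℝ (Fin 3))
        (p : ℝ → EuclideanSpace ℝ (Fin 3) → ℝ),
        IsClassicalNSSolutionOn (Ico 0 T) ν 0 u p →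
        IsLerayHopfOn T ν 0 (u 0) u →
        HasRapidSpatialDecay (u 0) →
        (∃ M : ℝ, (∀ t ∈ Ioo 0 T, ∀ x, -M ≤ normalisedPressure (u t) x) ∨
          (∀ t ∈ Ioo 0 T, ∀ x, ‖u t x‖ ^ 2 + 2 * normalisedPressure (u t) x ≤ M)) →
        ∀ x₀, IsBackwardBoundedAt u T x₀) :
    SereginSverak2002_pressureOneSidedBound := by
  intro ν T hν hT u p hs hLH hd hM t₀ ht₀ x₀
  rcases ht₀.2.lt_or_eq with hlt | rfl
  · exact IsBackwardBoundedAt.of_continuousOn hs.smooth_velocity.continuousOn ⟨ht₀.1, hlt⟩ x₀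
  · exact h ν t₀ hν hT u p hs hLH hd hM x₀

/-- The fact is equivalent to its final-time case (the converse is specialisation at `t₀ = T`).
[cite: SereginSverak2002, Main Theorem (abstract) – bounded case, content at t = T] -/
theorem iff_final_time :
    SereginSverak2002_pressureOneSidedBound ↔
      ∀ (ν T : ℝ), 0 < ν → 0 < T →
        ∀ (u : ℝ → EuclideanSpace ℝ (Fin 3) → EuclideanSpace ℝ (Fin 3))
          (p : ℝ → EuclideanSpace ℝ (Fin 3) → ℝ),
          IsClassicalNSSolutionOn (Ico 0 T) ν 0 u p →
          IsLerayHopfOn T ν 0 (u 0) u →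
          HasRapidSpatialDecay (u 0) →
          (∃ M : ℝ, (∀ t ∈ Ioo 0 T, ∀ x, -M ≤ normalisedPressure (u t) x) ∨
            (∀ t ∈ Ioo 0 T, ∀ x, ‖u t x‖ ^ 2 + 2 * normalisedPressure (u t) x ≤ M)) →
          ∀ x₀, IsBackwardBoundedAt u T x₀ :=
  ⟨fun h ν T hν hT u p hs hLH hd hM x₀ ↦ h ν T hν hT u p hs hLH hd hM T ⟨hT, le_rfl⟩ x₀,
    of_final_time⟩

/-- **`SereginSverak2002_pressureOneSidedBound` from `seregin_sverak_2002`.** The tree's other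
vendoring of the Seregin–Šverák 2002 main theorem (`SereginSverakPressure.lean`, transcribed from
Tran–Yu 2017, Thm. 1, `g ≡ K`) has the same hypotheses and the stronger conclusion "bounded on
`(δ, T) × ℝ³` for every `δ ∈ (0, T)`"; the head hypothesis is rescaled by
`‖u‖² + 2p̃ ≤ M → ‖u‖²/2 + p̃ ≤ M/2`, and the strip bound with `δ = t₀/2` is localised to the
backward cylinder of radius `√(t₀/2)` at `(t₀, x₀)` (`IsBackwardBoundedAt.of_bound_Ioo`).
[cite: SereginSverak2002, Main Theorem (abstract; restated as TranYu2017 Thm. 1, p. 2)] -/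
theorem of_seregin_sverak_2002 (h : seregin_sverak_2002) :
    SereginSverak2002_pressureOneSidedBound := by
  intro ν T hν hT u p hs hLH hd hM t₀ ht₀ x₀
  have hone : (∃ K : ℝ, ∀ t ∈ Ioo 0 T, ∀ x, ‖u t x‖ ^ 2 / 2 + normalisedPressure (u t) x ≤ K) ∨
      (∃ K : ℝ, ∀ t ∈ Ioo 0 T, ∀ x, -K ≤ normalisedPressure (u t) x) := by
    obtain ⟨M, hM | hM⟩ := hM
    · exact Or.inr ⟨M, hM⟩
    · refine Or.inl ⟨M / 2, fun t ht x ↦ ?_⟩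
      have hx := hM t ht x
      linarith
  have hδ : t₀ / 2 ∈ Ioo 0 T := ⟨by linarith [ht₀.1], by linarith [ht₀.1, ht₀.2]⟩
  obtain ⟨C, hC⟩ := h ν T hν hT u p hs hLH hd hone (t₀ / 2) hδ
  exact IsBackwardBoundedAt.of_bound_Ioo (by linarith [ht₀.1]) ht₀.2 hC x₀

/-- The final-time backward-cylinder form under `seregin_sverak_2002`: a pressure floor on
`[0, T)` gives `u` bounded on `(T - r², T) × B_r(x₀)` for some `r > 0`, at every `x₀` (the
consumers' continuation form is `seregin_sverak_2002.hasSmoothExtensionPast` on that side).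
[cite: SereginSverak2002, Main Theorem (abstract; restated as TranYu2017 Thm. 1, p. 2)] -/
theorem at_top_of_seregin_sverak_2002 (h : seregin_sverak_2002) {ν T : ℝ} (hν : 0 < ν)
    (hT : 0 < T) {u : ℝ → EuclideanSpace ℝ (Fin 3) → EuclideanSpace ℝ (Fin 3)}
    {p : ℝ → EuclideanSpace ℝ (Fin 3) → ℝ}
    (hs : IsClassicalNSSolutionOn (Ico 0 T) ν 0 u p) (hLH : IsLerayHopfOn T ν 0 (u 0) u)
    (hd : HasRapidSpatialDecay (u 0))
    (hM : ∃ M : ℝ, ∀ t ∈ Ico 0 T, ∀ x, -M ≤ normalisedPressure (u t) x)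
    (x₀ : EuclideanSpace ℝ (Fin 3)) :
    ∃ r > 0, ∃ C : ℝ, ∀ t ∈ Ioo (T - r ^ 2) T, ∀ x ∈ ball x₀ r, ‖u t x‖ ≤ C :=
  (of_seregin_sverak_2002 h).at_top hν hT hs hLH hd hM x₀

/-! ### Reduction to unit viscosity -/

/-- **Rapid spatial decay is preserved by constant multiples** (for a smooth field, as the datum
of a classical solution is): `∂ⁿ(c u₀) = c ∂ⁿu₀`. [folklore] -/
theorem hasRapidSpatialDecay_const_smul
    {u₀ : EuclideanSpace ℝ (Fin 3) → EuclideanSpace ℝ (Fin 3)} (hu : ContDiff ℝ (⊤ : ℕ∞) u₀)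
    (hd : HasRapidSpatialDecay u₀) (c : ℝ) : HasRapidSpatialDecay (c • u₀) := by
  intro n K
  obtain ⟨C, hC⟩ := hd n K
  refine ⟨|c| * C, fun x => ?_⟩
  have hn : ContDiffAt ℝ n u₀ x := (hu.of_le (by exact_mod_cast le_top)).contDiffAt
  rw [iteratedFDeriv_const_smul_apply hn, norm_smul, Real.norm_eq_abs]
  calc (1 + ‖x‖) ^ K * (|c| * ‖iteratedFDeriv ℝ n u₀ x‖)
      = |c| * ((1 + ‖x‖) ^ K * ‖iteratedFDeriv ℝ n u₀ x‖) := by ring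
    _ ≤ |c| * C := mul_le_mul_of_nonneg_left (hC x) (abs_nonneg c)

/-- **Seregin–Šverák 2002 (bounded majorant) from its unit-viscosity instance.** If the
conclusion of `SereginSverak2002_pressureOneSidedBound` holds for `ν = 1` (the hypothesis, written
out in full), it holds for every `ν > 0`: for data `(u, p)` at viscosity `ν` on `[0, T)` the
rescaled pair `v(s, x) = ν⁻¹ u(s/ν, x)`, `π(s, x) = ν⁻² p(s/ν, x)` is a classical solution at
viscosity `1` on `[0, νT)` (`IsClassicalNSSolutionOn.viscosityRescale_set`), Leray–Hopf from the
rapidly decaying datum `ν⁻¹ u₀` (`IsLerayHopfOn.viscosityRescale`), with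
`p̃[v(s)] = ν⁻² p̃[u(s/ν)]` (`normalisedPressure_smul`), so a pressure floor `-M` becomes the floor
`-ν⁻²M` and a head ceiling `M` the ceiling `ν⁻²M`; and `v` bounded on
`(νt₀ - r², νt₀) × B(x₀, r)` gives `u` bounded on `(t₀ - r'², t₀) × B(x₀, r')`, `r' = r / max(1, ν)`
("printed for `ν = 1`; `ν > 0` by scaling", Tao 2011, footnote 3).
[cite: SereginSverak2002, Main Theorem (abstract); scaling as in Tao2011 footnote 3] -/
theorem of_unitViscosity
    (h : ∀ (T : ℝ), 0 < T →
      ∀ (u : ℝ → EuclideanSpace ℝ (Fin 3) → EuclideanSpace ℝ (Fin 3))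
        (p : ℝ → EuclideanSpace ℝ (Fin 3) → ℝ),
        IsClassicalNSSolutionOn (Ico 0 T) 1 0 u p → IsLerayHopfOn T 1 0 (u 0) u →
        HasRapidSpatialDecay (u 0) →
        (∃ M : ℝ, (∀ t ∈ Ioo 0 T, ∀ x, -M ≤ normalisedPressure (u t) x) ∨
          (∀ t ∈ Ioo 0 T, ∀ x, ‖u t x‖ ^ 2 + 2 * normalisedPressure (u t) x ≤ M)) →
        ∀ t₀ ∈ Ioc 0 T, ∀ x₀, IsBackwardBoundedAt u t₀ x₀) :
    SereginSverak2002_pressureOneSidedBound := by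
  intro ν T hν hT u p hs hLH hd hM t₀ ht₀ x₀
  have hν0 : ν ≠ 0 := hν.ne'
  have hνi : 0 < ν⁻¹ := inv_pos.2 hν
  have hνT : 0 < ν * T := mul_pos hν hT
  -- the rescaled pair at viscosity `1` on `[0, νT)`
  set v : ℝ → EuclideanSpace ℝ (Fin 3) → EuclideanSpace ℝ (Fin 3) := timeRescale ν⁻¹ ν⁻¹ u
    with hv
  set π : ℝ → EuclideanSpace ℝ (Fin 3) → ℝ := timeRescale ν⁻¹ (ν⁻¹ ^ 2) p with hπ
  have hslice : ∀ s, v s = ν⁻¹ • u (ν⁻¹ * s) := fun s => rfl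
  have hmaps : MapsTo (fun s => ν⁻¹ * s) (Ico 0 (ν * T)) (Ico 0 T) := by
    intro s hs'
    refine ⟨mul_nonneg hνi.le hs'.1, ?_⟩
    calc ν⁻¹ * s < ν⁻¹ * (ν * T) := mul_lt_mul_of_pos_left hs'.2 hνi
      _ = T := by rw [← mul_assoc, inv_mul_cancel₀ hν0, one_mul]
  have hs' : IsClassicalNSSolutionOn (Ico 0 (ν * T)) 1 0 v π := by
    have := hs.viscosityRescale_set hν0 hmaps (uniqueDiffOn_Ico 0 (ν * T))
    rwa [timeRescale_zero_force] at this
  have hv0 : v 0 = ν⁻¹ • u 0 := by rw [hslice, mul_zero]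
  have hLH' : IsLerayHopfOn (ν * T) 1 0 (v 0) v := by
    have := hLH.viscosityRescale hνi
    rw [div_inv_eq_mul, mul_comm T ν, inv_mul_cancel₀ hν0, timeRescale_zero_force] at this
    rwa [hv0]
  have hd' : HasRapidSpatialDecay (v 0) := by
    rw [hv0]
    exact hasRapidSpatialDecay_const_smul (hs.contDiff_velocity ⟨le_rfl, hT⟩) hd ν⁻¹
  -- the one-sided bounds rescale by `ν⁻²`
  have hpress : ∀ s x,
      normalisedPressure (v s) x = ν⁻¹ ^ 2 * normalisedPressure (u (ν⁻¹ * s)) x :=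
    fun s x => by rw [hslice, normalisedPressure_smul]
  have hM' : ∃ M : ℝ, (∀ s ∈ Ioo 0 (ν * T), ∀ x, -M ≤ normalisedPressure (v s) x) ∨
      (∀ s ∈ Ioo 0 (ν * T), ∀ x, ‖v s x‖ ^ 2 + 2 * normalisedPressure (v s) x ≤ M) := by
    obtain ⟨M, hM | hM⟩ := hM
    · refine ⟨ν⁻¹ ^ 2 * M, Or.inl fun s hs'' x => ?_⟩
      have ht : ν⁻¹ * s ∈ Ioo 0 T := (inv_mul_mem_Ioo_iff hν).2 hs''
      have := mul_le_mul_of_nonneg_left (hM _ ht x) (sq_nonneg ν⁻¹)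
      rw [hpress]
      linarith
    · refine ⟨ν⁻¹ ^ 2 * M, Or.inr fun s hs'' x => ?_⟩
      have ht : ν⁻¹ * s ∈ Ioo 0 T := (inv_mul_mem_Ioo_iff hν).2 hs''
      have key := mul_le_mul_of_nonneg_left (hM _ ht x) (sq_nonneg ν⁻¹)
      have hnorm : ‖v s x‖ ^ 2 = ν⁻¹ ^ 2 * ‖u (ν⁻¹ * s) x‖ ^ 2 := by
        rw [hslice, Pi.smul_apply, norm_smul, Real.norm_eq_abs, abs_of_pos hνi]; ring
      rw [hpress, hnorm]
      linarith
  -- backward boundedness of `v` at `(ν t₀, x₀)`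
  have ht₀' : ν * t₀ ∈ Ioc 0 (ν * T) :=
    ⟨mul_pos hν ht₀.1, mul_le_mul_of_nonneg_left ht₀.2 hν.le⟩
  obtain ⟨r, hr, C, hC⟩ := h (ν * T) hνT v π hs' hLH' hd' hM' (ν * t₀) ht₀' x₀
  -- transport back: radius `r' = r / max 1 ν`
  set m : ℝ := max 1 ν with hm
  have hm1 : 1 ≤ m := le_max_left _ _
  have hmν : ν ≤ m := le_max_right _ _
  have hm0 : 0 < m := by positivity
  refine ⟨r / m, by positivity, ν * C, fun t ht x hx => ?_⟩
  have hrm : r / m ≤ r := div_le_self hr.le hm1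
  have hsq : ν * (r / m) ^ 2 ≤ r ^ 2 := by
    rw [div_pow]
    have hm2 : ν ≤ m ^ 2 := hmν.trans (by nlinarith)
    calc ν * (r ^ 2 / m ^ 2) = ν / m ^ 2 * r ^ 2 := by ring
      _ ≤ 1 * r ^ 2 := by
          refine mul_le_mul_of_nonneg_right ?_ (sq_nonneg r)
          rw [div_le_one (by positivity)]; exact hm2
      _ = r ^ 2 := one_mul _
  have hts : ν * t ∈ Ioo (ν * t₀ - r ^ 2) (ν * t₀) := by
    constructor
    · have h1 : ν * (t₀ - t) < ν * (r / m) ^ 2 := mul_lt_mul_of_pos_left (by linarith [ht.1]) hν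
      nlinarith
    · exact mul_lt_mul_of_pos_left ht.2 hν
  have hxs : x ∈ ball x₀ r := ball_subset_ball hrm hx
  have key := hC (ν * t) hts x hxs
  rw [hslice, Pi.smul_apply, ← mul_assoc, inv_mul_cancel₀ hν0, one_mul, norm_smul,
    Real.norm_eq_abs, abs_of_pos hνi] at key
  exact (inv_mul_le_iff₀ hν).1 key

end SereginSverak2002_pressureOneSidedBound

end Literature.Analysis.FluidPDE

end
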